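import Literature.AlgebraicGeometry.Deformation.InvertibleSheafExtensions
import Literature.AlgebraicGeometry.Deformation.MorphismLiftsSquareZeroAffine
import Literature.AlgebraicGeometry.Modules.CechPicToSheafCohomology
import Literature.AlgebraicGeometry.Modules.UnitCocyclePullback
import HarnessLib

/-!
# Sectionwise relations between differences `u_j♯ − u₀♯` transported to Čech cocycles of units and to `H¹(𝓘)`

Layer `Literature/AlgebraicGeometry/Deformation`, namespace `Literature.AlgebraicGeometry.Deformation`.  THEOREMS ONLY (no
definition, no named fact, no instance, no notation, no `sorry`).

Setting ([Hartshorne2010] §6, proof of Thm. 6.4; [Hartshorne1977] III §4, Ex. 4.4–4.5): `i : X ⟶ X'` a first-order thickening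
with ideal `𝓘`, morphisms `u₀, u_j : X' ⟶ Y` agreeing on `X`, a Čech cocycle of units `c` on `Y` (tree `Modules.UnitCocycle`,
point-indexed covers).  The pulled-back cocycles `u_j^*c` (tree `UnitCocycle.pullback`) have transition functions
`p_j := u_j♯(c_{ab})`, and the quotient cocycles `r_j := u_j^*c · (u₀^*c)⁻¹` are `≡ 1 (mod 𝓘)`; an `𝓘`-valued Čech cocycle
`x_j` with values `idealVal x_j = p_j q₀ − 1` (`q₀ := u₀♯(c_{ba}) = p₀⁻¹`) presents `[u_j^*c] − [u₀^*c] = H¹(truncExp)(q(x_j))`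
(tree-bound `Deformation/FirstOrderPairUnitsClassShift`, B-p19 (g18)).

* §1 **`UnitCocycle.pullback_g_sub_eq_mul_sub_of_forall_appLE`** ∕ **`UnitCocycle.pullback_g_sub_eq_add_sub_of_forall_appLE`**
  — BRIDGES: a relation between the differences `u_j.appLE U V g − u₀.appLE U V g` holding for ALL opens `U`, sections `g` and
  `V` (the output of the locality theorem of `Deformation/FirstOrderDifferenceLocality`) holds for all transition functions
  `(u_j^*c).g a b V` of every pulled-back cocycle (bookkeeping of the base points `u_j(a) = u₀(a)`): HOMOGENEITY
  `p₂ − p₀ = λ (p₁ − p₀)` — the hypothesis `hprop` of the tree-bound `cechToH_eq_map_of_sub_eq_mul_sub` — and ADDITIVITY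
  `p₃ − p₀ = (p₁ − p₀) + (p₂ − p₀)`.
* §2 **`cechToH_eq_add_of_pullback_g_sub_eq_add_sub`** — the ADDITIVE twin of the tree-bound scalar statement: if
  `p₃ − p₀ = (p₁ − p₀) + (p₂ − p₀)` on all transition functions, then the classes of the presenting `𝓘`-cocycles add up,
  `q(x₃) = q(x₁) + q(x₂)` in `H¹(X', 𝓘)` (values: `p₃q₀ − 1 = (p₁q₀ − 1) + (p₂q₀ − 1)` from `p₀q₀ = 1`; classes: refinement to the
  intersected cover, [Hartshorne1977] III Ex. 4.4 (b), tree `Motives.cechToH_eq_of_refine_sub_refine_mem`).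

These are the `(hadd)`∕`(hsmul)` transport steps of the Kodaira–Spencer count in [MumfordAV1970] §13 (proof of the Theorem,
pp. 125–127) for the cell's (Mc) N3′ letter S-e (brick K3).  Cell `hodgecm-mathlib` (D-0151), FLOOR 0, P1 F-3; author F0P1c-p03 (g0).
HC_CM is proved only modulo the 7 printed citations until rung 0 closes; nothing here is about HC.

## References
* [Hartshorne2010] R. Hartshorne, *Deformation Theory*, GTM 257 (2010), §6, proof of Thm. 6.4 (pp. 50–51).
* [Hartshorne1977] R. Hartshorne, *Algebraic Geometry* (1977), III §4, Ex. 4.4 (b), Ex. 4.5.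
* [MumfordAV1970] D. Mumford, *Abelian Varieties* (1970), §13, proof of the Theorem (pp. 125–127).
-/

noncomputable section

universe u

open CategoryTheory Opposite TopologicalSpace AlgebraicGeometry

namespace Literature.AlgebraicGeometry.Deformation

open Literature.AlgebraicGeometry.Motives Literature.AlgebraicGeometry.Modules

variable {X X' Y : Scheme.{u}} (i : X ⟶ X') [IsFirstOrderThickening i]

/-! ### §1 From relations for all `(U, g, V)` to relations for all transition functions of pulled-back cocycles -/

omit [IsFirstOrderThickening i] in
/-- The transition function of a pulled-back cocycle read at base points given up to propositional equality:
`(u^*c).g a b V = u♯_V (c_{p q})` whenever `p = u a`, `q = u b`. [cite: Hartshorne1977, III Ex. 4.5] -/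
private theorem pullback_g_eq_appLE_of_eq (u : X' ⟶ Y) (c : UnitCocycle Y) (a b : X') {p q : Y} (hp : u.base a = p)
    (hq : u.base b = q) (V : X'.Opens) (ha : V ≤ (UnitCocycle.pullback u c).U a) (hb : V ≤ (UnitCocycle.pullback u c).U b)
    (h : V ≤ u ⁻¹ᵁ (c.U p ⊓ c.U q)) :
    (UnitCocycle.pullback u c).g a b V ha hb = u.appLE (c.U p ⊓ c.U q) V h (c.g p q _ inf_le_left inf_le_right) := by
  subst hp; subst hq; rfl

/-- **BRIDGE (homogeneity).**  If `u₂♯ g − u₀♯ g = λ|_V · (u₁♯ g − u₀♯ g)` for ALL opens `U ⊆ Y`, sections `g ∈ Γ(Y, U)` and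
opens `V` of `X'` below the three preimages (`u_j` agreeing with `u₀` on the first-order thickening `X`), then for every Čech
cocycle of units `c` on `Y` the transition functions of the pulled-back cocycles satisfy
`(u₂^*c)_{ab} − (u₀^*c)_{ab} = λ|_V · ((u₁^*c)_{ab} − (u₀^*c)_{ab})` on every `V` — the hypothesis `hprop` of the scalar
class statement of `Deformation/FirstOrderPairUnitsClassShift`. [cite: Hartshorne2010, §6 proof of Thm. 6.4, pp. 50–51]
[cite: Hartshorne1977, III Ex. 4.5] -/
theorem UnitCocycle.pullback_g_sub_eq_mul_sub_of_forall_appLE (u₀ u₁ u₂ : X' ⟶ Y) (hu₁ : i ≫ u₁ = i ≫ u₀)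
    (hu₂ : i ≫ u₂ = i ≫ u₀) (lam : Γ(X', ⊤))
    (H : ∀ (U : Y.Opens) (g : Γ(Y, U)) (V : X'.Opens) (h₀ : V ≤ u₀ ⁻¹ᵁ U) (h₁ : V ≤ u₁ ⁻¹ᵁ U) (h₂ : V ≤ u₂ ⁻¹ᵁ U),
      u₂.appLE U V h₂ g - u₀.appLE U V h₀ g = secRes X' (le_top : V ≤ ⊤) lam * (u₁.appLE U V h₁ g - u₀.appLE U V h₀ g))
    (c : UnitCocycle Y) (a b : X') (V : X'.Opens)
    (h₀a : V ≤ (UnitCocycle.pullback u₀ c).U a) (h₀b : V ≤ (UnitCocycle.pullback u₀ c).U b)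
    (h₁a : V ≤ (UnitCocycle.pullback u₁ c).U a) (h₁b : V ≤ (UnitCocycle.pullback u₁ c).U b)
    (h₂a : V ≤ (UnitCocycle.pullback u₂ c).U a) (h₂b : V ≤ (UnitCocycle.pullback u₂ c).U b) :
    (UnitCocycle.pullback u₂ c).g a b V h₂a h₂b - (UnitCocycle.pullback u₀ c).g a b V h₀a h₀b =
      secRes X' (le_top : V ≤ ⊤) lam *
        ((UnitCocycle.pullback u₁ c).g a b V h₁a h₁b - (UnitCocycle.pullback u₀ c).g a b V h₀a h₀b) := by
  have hb₁ : u₁.base = u₀.base := base_eq_of_comp_eq i hu₁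
  have hb₂ : u₂.base = u₀.base := base_eq_of_comp_eq i hu₂
  have e₀ : V ≤ u₀ ⁻¹ᵁ (c.U (u₀.base a) ⊓ c.U (u₀.base b)) := UnitCocycle.le_preimage_inf u₀ h₀a h₀b
  have e₁ : V ≤ u₁ ⁻¹ᵁ (c.U (u₀.base a) ⊓ c.U (u₀.base b)) := by
    rw [preimage_eq_of_comp_eq i hu₁]; exact e₀
  have e₂ : V ≤ u₂ ⁻¹ᵁ (c.U (u₀.base a) ⊓ c.U (u₀.base b)) := by
    rw [preimage_eq_of_comp_eq i hu₂]; exact e₀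
  rw [pullback_g_eq_appLE_of_eq u₀ c a b rfl rfl V h₀a h₀b e₀,
    pullback_g_eq_appLE_of_eq u₁ c a b (congrArg (fun φ => φ a) hb₁) (congrArg (fun φ => φ b) hb₁) V h₁a h₁b e₁,
    pullback_g_eq_appLE_of_eq u₂ c a b (congrArg (fun φ => φ a) hb₂) (congrArg (fun φ => φ b) hb₂) V h₂a h₂b e₂]
  exact H _ _ V e₀ e₁ e₂

/-- **BRIDGE (additivity).**  If `u₃♯ g − u₀♯ g = (u₁♯ g − u₀♯ g) + (u₂♯ g − u₀♯ g)` for ALL `U`, `g ∈ Γ(Y, U)`, `V` (`u_j`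
agreeing with `u₀` on the first-order thickening `X`), then for every Čech cocycle of units `c` on `Y`:
`(u₃^*c)_{ab} − (u₀^*c)_{ab} = ((u₁^*c)_{ab} − (u₀^*c)_{ab}) + ((u₂^*c)_{ab} − (u₀^*c)_{ab})` on every `V`.
[cite: Hartshorne2010, §6 proof of Thm. 6.4, pp. 50–51] [cite: Hartshorne1977, III Ex. 4.5] -/
theorem UnitCocycle.pullback_g_sub_eq_add_sub_of_forall_appLE (u₀ u₁ u₂ u₃ : X' ⟶ Y) (hu₁ : i ≫ u₁ = i ≫ u₀)
    (hu₂ : i ≫ u₂ = i ≫ u₀) (hu₃ : i ≫ u₃ = i ≫ u₀)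
    (H : ∀ (U : Y.Opens) (g : Γ(Y, U)) (V : X'.Opens) (h₀ : V ≤ u₀ ⁻¹ᵁ U) (h₁ : V ≤ u₁ ⁻¹ᵁ U) (h₂ : V ≤ u₂ ⁻¹ᵁ U)
      (h₃ : V ≤ u₃ ⁻¹ᵁ U),
      u₃.appLE U V h₃ g - u₀.appLE U V h₀ g =
        (u₁.appLE U V h₁ g - u₀.appLE U V h₀ g) + (u₂.appLE U V h₂ g - u₀.appLE U V h₀ g))
    (c : UnitCocycle Y) (a b : X') (V : X'.Opens)
    (h₀a : V ≤ (UnitCocycle.pullback u₀ c).U a) (h₀b : V ≤ (UnitCocycle.pullback u₀ c).U b)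
    (h₁a : V ≤ (UnitCocycle.pullback u₁ c).U a) (h₁b : V ≤ (UnitCocycle.pullback u₁ c).U b)
    (h₂a : V ≤ (UnitCocycle.pullback u₂ c).U a) (h₂b : V ≤ (UnitCocycle.pullback u₂ c).U b)
    (h₃a : V ≤ (UnitCocycle.pullback u₃ c).U a) (h₃b : V ≤ (UnitCocycle.pullback u₃ c).U b) :
    (UnitCocycle.pullback u₃ c).g a b V h₃a h₃b - (UnitCocycle.pullback u₀ c).g a b V h₀a h₀b =
      ((UnitCocycle.pullback u₁ c).g a b V h₁a h₁b - (UnitCocycle.pullback u₀ c).g a b V h₀a h₀b) +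
        ((UnitCocycle.pullback u₂ c).g a b V h₂a h₂b - (UnitCocycle.pullback u₀ c).g a b V h₀a h₀b) := by
  have hb₁ : u₁.base = u₀.base := base_eq_of_comp_eq i hu₁
  have hb₂ : u₂.base = u₀.base := base_eq_of_comp_eq i hu₂
  have hb₃ : u₃.base = u₀.base := base_eq_of_comp_eq i hu₃
  have e₀ : V ≤ u₀ ⁻¹ᵁ (c.U (u₀.base a) ⊓ c.U (u₀.base b)) := UnitCocycle.le_preimage_inf u₀ h₀a h₀b
  have e₁ : V ≤ u₁ ⁻¹ᵁ (c.U (u₀.base a) ⊓ c.U (u₀.base b)) := by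
    rw [preimage_eq_of_comp_eq i hu₁]; exact e₀
  have e₂ : V ≤ u₂ ⁻¹ᵁ (c.U (u₀.base a) ⊓ c.U (u₀.base b)) := by
    rw [preimage_eq_of_comp_eq i hu₂]; exact e₀
  have e₃ : V ≤ u₃ ⁻¹ᵁ (c.U (u₀.base a) ⊓ c.U (u₀.base b)) := by
    rw [preimage_eq_of_comp_eq i hu₃]; exact e₀
  rw [pullback_g_eq_appLE_of_eq u₀ c a b rfl rfl V h₀a h₀b e₀,
    pullback_g_eq_appLE_of_eq u₁ c a b (congrArg (fun φ => φ a) hb₁) (congrArg (fun φ => φ b) hb₁) V h₁a h₁b e₁,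
    pullback_g_eq_appLE_of_eq u₂ c a b (congrArg (fun φ => φ a) hb₂) (congrArg (fun φ => φ b) hb₂) V h₂a h₂b e₂,
    pullback_g_eq_appLE_of_eq u₃ c a b (congrArg (fun φ => φ a) hb₃) (congrArg (fun φ => φ b) hb₃) V h₃a h₃b e₃]
  exact H _ _ V e₀ e₁ e₂ e₃

/-! ### §2 Additivity of the presenting `𝓘`-cocycle classes -/

omit [IsFirstOrderThickening i] in
/-- A point-indexed family of opens with `a ∈ U a` covers. [cite: Hartshorne1977, III Ex. 4.4 (b)] -/
private theorem iSup_U_eq_top_of_forall_mem {U : X' → X'.Opens} (hU : ∀ a, a ∈ U a) : iSup U = ⊤ :=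
  top_le_iff.mp fun x _ => Opens.mem_iSup.2 ⟨x, hU x⟩

omit [IsFirstOrderThickening i] in
/-- Values of restrictions of an `𝓘`-cocycle presented as `r − 1`. [cite: Hartshorne1977, III Ex. 4.5] -/
private theorem idealVal_sheafSecRes_eq_g_sub_one (r : UnitCocycle X') (x : CechOneCochain (idealSheafAb i) r.U)
    (hx : ∀ a b : X', idealVal i (r.U a ⊓ r.U b) (x a b) = r.g a b (r.U a ⊓ r.U b) inf_le_left inf_le_right - 1)
    (a b : X') {V : X'.Opens} (h : V ≤ r.U a ⊓ r.U b) :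
    idealVal i V (sheafSecRes (idealSheafAb i) h (x a b)) = r.g a b V (h.trans inf_le_left) (h.trans inf_le_right) - 1 := by
  rw [← r.map_g a b inf_le_left inf_le_right h, ← map_one (Modules.secRes X' h), ← map_sub, ← hx]
  exact (secRes_idealVal i h (x a b)).symm

omit [IsFirstOrderThickening i] in
/-- Cover independence for `𝓘`-cocycles on point-indexed covers: two Čech `1`-cocycles of `𝓘` on covers `(U_a)`, `(U'_a)`
(`a ∈ U_a`, `a ∈ U'_a`) whose values agree on `(U_a ∩ U'_a) ∩ (U_b ∩ U'_b)` have the same class in `H¹(X', 𝓘)`.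
[cite: Hartshorne1977, III Ex. 4.4 (b)] -/
private theorem cechToH_eq_of_forall_secRes_idealVal_eq {U U' : X' → X'.Opens} (hU : ∀ a, a ∈ U a) (hU' : ∀ a, a ∈ U' a)
    (x : cechOneCocycles (idealSheafAb i) U) (x' : cechOneCocycles (idealSheafAb i) U')
    (h : ∀ a b : X',
      Modules.secRes X' (inf_le_inf inf_le_left inf_le_left : (U a ⊓ U' a) ⊓ (U b ⊓ U' b) ≤ U a ⊓ U b)
          (idealVal i _ ((x : CechOneCochain (idealSheafAb i) U) a b)) =
        Modules.secRes X' (inf_le_inf inf_le_right inf_le_right : (U a ⊓ U' a) ⊓ (U b ⊓ U' b) ≤ U' a ⊓ U' b)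
          (idealVal i _ ((x' : CechOneCochain (idealSheafAb i) U') a b))) :
    cechToH (idealSheafAb i) U (iSup_U_eq_top_of_forall_mem hU) x = cechToH (idealSheafAb i) U' (iSup_U_eq_top_of_forall_mem hU') x' := by
  refine cechToH_eq_of_refine_sub_refine_mem (idealSheafAb i) U U' (fun a => U a ⊓ U' a) id id
    (fun a => inf_le_left) (fun a => inf_le_right) _ _ (iSup_U_eq_top_of_forall_mem fun a => ⟨hU a, hU' a⟩) x x' ?_
  have h0 : (CechOneCochain.refine (idealSheafAb i) U (fun a => U a ⊓ U' a) id (fun a => inf_le_left) x :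
      CechOneCochain (idealSheafAb i) fun a => U a ⊓ U' a) =
      CechOneCochain.refine (idealSheafAb i) U' (fun a => U a ⊓ U' a) id (fun a => inf_le_right) x' := by
    funext a b
    rw [CechOneCochain.refine_apply, CechOneCochain.refine_apply]
    apply idealVal_injective i
    rw [← secRes_idealVal, ← secRes_idealVal]
    exact h a b
  rw [h0, sub_self]
  exact zero_mem _

omit [IsFirstOrderThickening i] in
/-- **ADDITIVITY OF THE CLASS SHIFTS.**  Let `u₀ u₁ u₂ u₃ : X' ⟶ Y`, `c` a Čech cocycle of units on `Y`, and for `j = 1, 2, 3` let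
`x_j` be an `𝓘`-valued Čech cocycle presenting the quotient `r_j := u_j^*c · (u₀^*c)⁻¹` as `idealVal x_j = r_j − 1` (the cocycles of
the pair theorem of `Deformation/FirstOrderPairUnitsClassShift`, so that `[u_j^*c] = [u₀^*c] + H¹(truncExp)(q(x_j))`).  If the
transition functions satisfy `(u₃^*c) − (u₀^*c) = ((u₁^*c) − (u₀^*c)) + ((u₂^*c) − (u₀^*c))` sectionwise, then
`q(x₃) = q(x₁) + q(x₂)` in `H¹(X', 𝓘)` — on cochains `p₃q₀ − 1 = (p₁q₀ − 1) + (p₂q₀ − 1)` because `p₀q₀ = 1`; then cover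
independence ([Hartshorne1977] III Ex. 4.4 (b)).  This is the additivity half of the linearity of the Kodaira–Spencer
difference classes ([MumfordAV1970] §13 p. 126). [cite: Hartshorne2010, §6 proof of Thm. 6.4, pp. 50–51]
[cite: Hartshorne1977, III Ex. 4.4 (b) and Ex. 4.5] [cite: MumfordAV1970, §13 (proof of the Thm. pp. 125–127)] -/
theorem cechToH_eq_add_of_pullback_g_sub_eq_add_sub (u₀ u₁ u₂ u₃ : X' ⟶ Y) (c : UnitCocycle Y)
    (hprop : ∀ (a b : X') (V : X'.Opens)
      (h₀a : V ≤ (UnitCocycle.pullback u₀ c).U a) (h₀b : V ≤ (UnitCocycle.pullback u₀ c).U b)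
      (h₁a : V ≤ (UnitCocycle.pullback u₁ c).U a) (h₁b : V ≤ (UnitCocycle.pullback u₁ c).U b)
      (h₂a : V ≤ (UnitCocycle.pullback u₂ c).U a) (h₂b : V ≤ (UnitCocycle.pullback u₂ c).U b)
      (h₃a : V ≤ (UnitCocycle.pullback u₃ c).U a) (h₃b : V ≤ (UnitCocycle.pullback u₃ c).U b),
      (UnitCocycle.pullback u₃ c).g a b V h₃a h₃b - (UnitCocycle.pullback u₀ c).g a b V h₀a h₀b =
        ((UnitCocycle.pullback u₁ c).g a b V h₁a h₁b - (UnitCocycle.pullback u₀ c).g a b V h₀a h₀b) +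
          ((UnitCocycle.pullback u₂ c).g a b V h₂a h₂b - (UnitCocycle.pullback u₀ c).g a b V h₀a h₀b))
    (x₁ : cechOneCocycles (idealSheafAb i)
      (UnitCocycle.mul (UnitCocycle.pullback u₁ c) (UnitCocycle.inv (UnitCocycle.pullback u₀ c))).U)
    (x₂ : cechOneCocycles (idealSheafAb i)
      (UnitCocycle.mul (UnitCocycle.pullback u₂ c) (UnitCocycle.inv (UnitCocycle.pullback u₀ c))).U)
    (x₃ : cechOneCocycles (idealSheafAb i)
      (UnitCocycle.mul (UnitCocycle.pullback u₃ c) (UnitCocycle.inv (UnitCocycle.pullback u₀ c))).U)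
    (hx₁ : ∀ a b : X', idealVal i _ ((x₁ : CechOneCochain (idealSheafAb i) _) a b) =
      (UnitCocycle.mul (UnitCocycle.pullback u₁ c) (UnitCocycle.inv (UnitCocycle.pullback u₀ c))).g a b _
        inf_le_left inf_le_right - 1)
    (hx₂ : ∀ a b : X', idealVal i _ ((x₂ : CechOneCochain (idealSheafAb i) _) a b) =
      (UnitCocycle.mul (UnitCocycle.pullback u₂ c) (UnitCocycle.inv (UnitCocycle.pullback u₀ c))).g a b _
        inf_le_left inf_le_right - 1)
    (hx₃ : ∀ a b : X', idealVal i _ ((x₃ : CechOneCochain (idealSheafAb i) _) a b) =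
      (UnitCocycle.mul (UnitCocycle.pullback u₃ c) (UnitCocycle.inv (UnitCocycle.pullback u₀ c))).g a b _
        inf_le_left inf_le_right - 1) :
    cechToH (idealSheafAb i) _
        (UnitCocycle.mul (UnitCocycle.pullback u₃ c) (UnitCocycle.inv (UnitCocycle.pullback u₀ c))).iSup_U_eq_top x₃ =
      cechToH (idealSheafAb i) _
          (UnitCocycle.mul (UnitCocycle.pullback u₁ c) (UnitCocycle.inv (UnitCocycle.pullback u₀ c))).iSup_U_eq_top x₁ +
        cechToH (idealSheafAb i) _
          (UnitCocycle.mul (UnitCocycle.pullback u₂ c) (UnitCocycle.inv (UnitCocycle.pullback u₀ c))).iSup_U_eq_top x₂ := by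
  -- the sum of the refinements of `x₁`, `x₂` to the intersected cover `W`
  let W : X' → X'.Opens := fun a => (UnitCocycle.mul (UnitCocycle.pullback u₁ c) (UnitCocycle.inv (UnitCocycle.pullback u₀ c))).U a ⊓ (UnitCocycle.mul (UnitCocycle.pullback u₂ c) (UnitCocycle.inv (UnitCocycle.pullback u₀ c))).U a
  have hW : ∀ a, a ∈ W a := fun a => ⟨(UnitCocycle.mul (UnitCocycle.pullback u₁ c) (UnitCocycle.inv (UnitCocycle.pullback u₀ c))).mem a, (UnitCocycle.mul (UnitCocycle.pullback u₂ c) (UnitCocycle.inv (UnitCocycle.pullback u₀ c))).mem a⟩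
  let y : cechOneCocycles (idealSheafAb i) W :=
    cechOneCocyclesRefine (idealSheafAb i) (UnitCocycle.mul (UnitCocycle.pullback u₁ c) (UnitCocycle.inv (UnitCocycle.pullback u₀ c))).U W id (fun a => inf_le_left) x₁ +
      cechOneCocyclesRefine (idealSheafAb i) (UnitCocycle.mul (UnitCocycle.pullback u₂ c) (UnitCocycle.inv (UnitCocycle.pullback u₀ c))).U W id (fun a => inf_le_right) x₂
  have hy : cechToH (idealSheafAb i) W (iSup_U_eq_top_of_forall_mem hW) y =
      cechToH (idealSheafAb i) _ (UnitCocycle.mul (UnitCocycle.pullback u₁ c) (UnitCocycle.inv (UnitCocycle.pullback u₀ c))).iSup_U_eq_top x₁ + cechToH (idealSheafAb i) _ (UnitCocycle.mul (UnitCocycle.pullback u₂ c) (UnitCocycle.inv (UnitCocycle.pullback u₀ c))).iSup_U_eq_top x₂ := by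
    rw [map_add, cechToH_refine, cechToH_refine]
  rw [← hy]
  symm
  -- compare `y` with `x₃` on the common intersections
  refine cechToH_eq_of_forall_secRes_idealVal_eq i hW (UnitCocycle.mul (UnitCocycle.pullback u₃ c) (UnitCocycle.inv (UnitCocycle.pullback u₀ c))).mem y x₃ fun a b => ?_
  have hQ₁ : (W a ⊓ (UnitCocycle.mul (UnitCocycle.pullback u₃ c) (UnitCocycle.inv (UnitCocycle.pullback u₀ c))).U a) ⊓ (W b ⊓ (UnitCocycle.mul (UnitCocycle.pullback u₃ c) (UnitCocycle.inv (UnitCocycle.pullback u₀ c))).U b) ≤ W a ⊓ W b := inf_le_inf inf_le_left inf_le_left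
  have hQ₂ : (W a ⊓ (UnitCocycle.mul (UnitCocycle.pullback u₃ c) (UnitCocycle.inv (UnitCocycle.pullback u₀ c))).U a) ⊓ (W b ⊓ (UnitCocycle.mul (UnitCocycle.pullback u₃ c) (UnitCocycle.inv (UnitCocycle.pullback u₀ c))).U b) ≤ (UnitCocycle.mul (UnitCocycle.pullback u₃ c) (UnitCocycle.inv (UnitCocycle.pullback u₀ c))).U a ⊓ (UnitCocycle.mul (UnitCocycle.pullback u₃ c) (UnitCocycle.inv (UnitCocycle.pullback u₀ c))).U b := inf_le_inf inf_le_right inf_le_right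
  rw [secRes_idealVal, secRes_idealVal]
  change idealVal i _ (sheafSecRes (idealSheafAb i) hQ₁ ((y : CechOneCochain (idealSheafAb i) W) a b)) =
    idealVal i _ (sheafSecRes (idealSheafAb i) hQ₂ ((x₃ : CechOneCochain (idealSheafAb i) _) a b))
  rw [idealVal_sheafSecRes_eq_g_sub_one i (UnitCocycle.mul (UnitCocycle.pullback u₃ c) (UnitCocycle.inv (UnitCocycle.pullback u₀ c))) x₃ hx₃ a b hQ₂]
  have hyab : ((y : CechOneCochain (idealSheafAb i) W) a b) =
      sheafSecRes (idealSheafAb i) (inf_le_inf inf_le_left inf_le_left : W a ⊓ W b ≤ (UnitCocycle.mul (UnitCocycle.pullback u₁ c) (UnitCocycle.inv (UnitCocycle.pullback u₀ c))).U a ⊓ (UnitCocycle.mul (UnitCocycle.pullback u₁ c) (UnitCocycle.inv (UnitCocycle.pullback u₀ c))).U b)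
          ((x₁ : CechOneCochain (idealSheafAb i) _) a b) +
        sheafSecRes (idealSheafAb i) (inf_le_inf inf_le_right inf_le_right : W a ⊓ W b ≤ (UnitCocycle.mul (UnitCocycle.pullback u₂ c) (UnitCocycle.inv (UnitCocycle.pullback u₀ c))).U a ⊓ (UnitCocycle.mul (UnitCocycle.pullback u₂ c) (UnitCocycle.inv (UnitCocycle.pullback u₀ c))).U b)
          ((x₂ : CechOneCochain (idealSheafAb i) _) a b) := rfl
  rw [hyab, map_add, idealVal_add, sheafSecRes_sheafSecRes, sheafSecRes_sheafSecRes,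
    idealVal_sheafSecRes_eq_g_sub_one i (UnitCocycle.mul (UnitCocycle.pullback u₁ c) (UnitCocycle.inv (UnitCocycle.pullback u₀ c))) x₁ hx₁ a b, idealVal_sheafSecRes_eq_g_sub_one i (UnitCocycle.mul (UnitCocycle.pullback u₂ c) (UnitCocycle.inv (UnitCocycle.pullback u₀ c))) x₂ hx₂ a b]
  -- the algebra `(p₁q₀ − 1) + (p₂q₀ − 1) = p₃q₀ − 1` from `p₃ − p₀ = (p₁ − p₀) + (p₂ − p₀)` and `p₀q₀ = 1`
  set Q : X'.Opens := (W a ⊓ (UnitCocycle.mul (UnitCocycle.pullback u₃ c) (UnitCocycle.inv (UnitCocycle.pullback u₀ c))).U a) ⊓ (W b ⊓ (UnitCocycle.mul (UnitCocycle.pullback u₃ c) (UnitCocycle.inv (UnitCocycle.pullback u₀ c))).U b) with hQdef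
  have hQa₀ : Q ≤ (UnitCocycle.pullback u₀ c).U a := (hQ₂.trans inf_le_left).trans inf_le_right
  have hQb₀ : Q ≤ (UnitCocycle.pullback u₀ c).U b := (hQ₂.trans inf_le_right).trans inf_le_right
  have hQa₁ : Q ≤ (UnitCocycle.pullback u₁ c).U a := ((hQ₁.trans inf_le_left).trans inf_le_left).trans inf_le_left
  have hQb₁ : Q ≤ (UnitCocycle.pullback u₁ c).U b := ((hQ₁.trans inf_le_right).trans inf_le_left).trans inf_le_left
  have hQa₂ : Q ≤ (UnitCocycle.pullback u₂ c).U a := ((hQ₁.trans inf_le_left).trans inf_le_right).trans inf_le_left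
  have hQb₂ : Q ≤ (UnitCocycle.pullback u₂ c).U b := ((hQ₁.trans inf_le_right).trans inf_le_right).trans inf_le_left
  have hQa₃ : Q ≤ (UnitCocycle.pullback u₃ c).U a := (hQ₂.trans inf_le_left).trans inf_le_left
  have hQb₃ : Q ≤ (UnitCocycle.pullback u₃ c).U b := (hQ₂.trans inf_le_right).trans inf_le_left
  have h00 := (UnitCocycle.pullback u₀ c).g_mul_symm a b Q hQa₀ hQb₀
  have hp := hprop a b Q hQa₀ hQb₀ hQa₁ hQb₁ hQa₂ hQb₂ hQa₃ hQb₃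
  change (UnitCocycle.pullback u₁ c).g a b Q hQa₁ hQb₁ * (UnitCocycle.pullback u₀ c).g b a Q hQb₀ hQa₀ - 1 +
      ((UnitCocycle.pullback u₂ c).g a b Q hQa₂ hQb₂ * (UnitCocycle.pullback u₀ c).g b a Q hQb₀ hQa₀ - 1) =
    (UnitCocycle.pullback u₃ c).g a b Q hQa₃ hQb₃ * (UnitCocycle.pullback u₀ c).g b a Q hQb₀ hQa₀ - 1
  linear_combination (-(UnitCocycle.pullback u₀ c).g b a Q hQb₀ hQa₀) * hp + h00

end Literature.AlgebraicGeometry.Deformation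

end
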